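import Mathlib
import Summits.ValiantsHypothesis.ValiantsHypothesis.Theorems.LacunarySymmetroidMatrixDescartesInertiaTypeRuns
import Summits.ValiantsHypothesis.ValiantsHypothesis.Theorems.LacunarySymmetroidMatrixDescartesStubNegRoots
import Summits.ValiantsHypothesis.ValiantsHypothesis.Theorems.LacunarySymmetroidMatrixDescartesCensusFatSectors

/-!
# `MatrixDescartes` (stmt-ValiantsHypothesis-18050) — the FEW-TYPE-RUNS SECTOR in the crux's currency: at most `K + 1` type runs on
# each half-line ⇒ `Z ≤ 2(K+1)m + 1` distinct real zeros ⇒ the crux inequality at every fat format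

HONEST FRAMING.  Cell `pub-symmetroid`, seat `val-sym-mdr-p2` (gen 17); helper LEAF file `--supports` the crux
`Theses.LacunarySymmetroid.MatrixDescartes`, NO closure claim.  Like `…DefiniteMomentsMDR`, `…ZonesMDR`, `…OneCrossingMDR`,
`…InertiaOneTypeMDR` it imports the census cone's `Census.fatFormat_absorb` (theses-cone warning: leaf file, nothing imports it).  The
broadest format-free family of this lineage on which the crux inequality `Z^q ≤ 2^{K⌊log₂K⌋}` is PROVED at every admissible size:
it is cut out by FIRST-ORDER DATA AT THE ROOTS only (the signs of the kernel forms), contains the hyperbolic sector (`K − 1` runs of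
alternating type), the one-crossing / one-type sectors (one run) and the sign-word sectors with their test scales; what it excludes
is exactly «more than `K + 1` alternations of crossing direction along the positive axis» — the interleaved revivals of g16's
§4c reading.  Nothing here bears on the crux in its window, on `stub_twoSided`, on `DoorA26`/`DoorA34`, registers, or `VP ≠ VNP`.

CONTENT.  A TYPE-RUN PARTITION with `K + 1` windows for the letters `S`: separators `0 < w₀ < ⋯ < w_{K+1}`, non-singular for
`F(x) = ∑ x^{dₖ}Sₖ`, enclosing every positive root of `det F`, each window `(wᵢ, wᵢ₊₁)` carrying roots of one definite type (or
none).  (§1) `typeRuns_realRoots_le`: type-run partitions with `K + 1` windows for `S` and for the reflected letters `(−1)^{dₖ}Sₖ`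
give `Z ≤ (K+1)m + (K+1)m + 1` (`Inertia.card_posRoots_multiset_le_mul_of_typeRuns` twice + `stub_negRoots`).  (§2) `typeRuns_mdr`:
hence `Z^q ≤ 2^{K⌊log₂K⌋}` for `K ≥ K₀(c, q)`, `m ≤ 2^{(⌊log₂K⌋+c)^c}`. [folklore]; axioms standard; no definitions.
-/

-- layout Summits/ValiantsHypothesis/ValiantsHypothesis forces the duplicated namespace component
set_option linter.dupNamespace false

namespace Summit.ValiantsHypothesis.ValiantsHypothesis.Theorems.LacunarySymmetroidMatrixDescartes

open Polynomial Matrix Finset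
open scoped BigOperators Topology

namespace Inertia

/-! ## §1 Both half-lines -/

/-- **`K + 1` type runs ⇒ `Z₊ ≤ (K+1)·m` distinct positive roots.** [folklore] -/
theorem card_posRoots_le_of_typeRuns {K m : ℕ} (d : Fin K → ℕ) (S : Fin K → Matrix (Fin m) (Fin m) ℝ)
    (hS : ∀ l, (S l).IsSymm)
    (hruns : ∃ w : Fin (K + 2) → ℝ, StrictMono w ∧ 0 < w 0 ∧ (∀ i, (∑ k, w i ^ d k • S k).det ≠ 0) ∧
      (∀ t, 0 < t → (∑ k, t ^ d k • S k).det = 0 → w 0 < t ∧ t < w (Fin.last (K + 1))) ∧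
      (∀ i : Fin (K + 1),
        (∀ t, w i.castSucc < t → t < w i.succ → (∑ k, t ^ d k • S k).det = 0 → ∀ u : Fin m → ℝ,
          (∑ k, t ^ d k • S k) *ᵥ u = 0 → u ≠ 0 →
            (derivative (∑ k, C (u ⬝ᵥ (S k *ᵥ u)) * (X : ℝ[X]) ^ d k)).eval t < 0) ∨
        (∀ t, w i.castSucc < t → t < w i.succ → (∑ k, t ^ d k • S k).det = 0 → ∀ u : Fin m → ℝ,
          (∑ k, t ^ d k • S k) *ᵥ u = 0 → u ≠ 0 →
            0 < (derivative (∑ k, C (u ⬝ᵥ (S k *ᵥ u)) * (X : ℝ[X]) ^ d k)).eval t))) :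
    ((Matrix.det (∑ k, ((X : ℝ[X]) ^ d k) • (S k).map C)).roots.toFinset.filter (fun t => 0 < t)).card ≤ (K + 1) * m := by
  classical
  obtain ⟨w, hw, hw0, hns, henc, hr⟩ := hruns
  have h := card_posRoots_multiset_le_mul_of_typeRuns d S hS (K + 1) w hw hw0 hns henc hr
  rw [Fintype.card_fin] at h
  refine le_trans ?_ h
  rw [← Multiset.toFinset_filter]
  exact Multiset.toFinset_card_le _

/-- **Real zeros on the two-sided few-type-runs sector.**  Real symmetric `m × m` letters; if `F(X)` and the reflected pencil
`F(−X) = ∑ X^{dₗ}((−1)^{dₗ}Sₗ)` both admit type-run partitions with `K + 1` windows, then `det F` has at most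
`(K+1)m + (K+1)m + 1` distinct real zeros. [folklore] -/
theorem typeRuns_realRoots_le (K m : ℕ) (d : Fin K → ℕ) (S : Fin K → Matrix (Fin m) (Fin m) ℝ) (hS : ∀ l, (S l).IsSymm)
    (hruns : ∃ w : Fin (K + 2) → ℝ, StrictMono w ∧ 0 < w 0 ∧ (∀ i, (∑ k, w i ^ d k • S k).det ≠ 0) ∧
      (∀ t, 0 < t → (∑ k, t ^ d k • S k).det = 0 → w 0 < t ∧ t < w (Fin.last (K + 1))) ∧
      (∀ i : Fin (K + 1),
        (∀ t, w i.castSucc < t → t < w i.succ → (∑ k, t ^ d k • S k).det = 0 → ∀ u : Fin m → ℝ,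
          (∑ k, t ^ d k • S k) *ᵥ u = 0 → u ≠ 0 →
            (derivative (∑ k, C (u ⬝ᵥ (S k *ᵥ u)) * (X : ℝ[X]) ^ d k)).eval t < 0) ∨
        (∀ t, w i.castSucc < t → t < w i.succ → (∑ k, t ^ d k • S k).det = 0 → ∀ u : Fin m → ℝ,
          (∑ k, t ^ d k • S k) *ᵥ u = 0 → u ≠ 0 →
            0 < (derivative (∑ k, C (u ⬝ᵥ (S k *ᵥ u)) * (X : ℝ[X]) ^ d k)).eval t)))
    (hruns' : ∃ w : Fin (K + 2) → ℝ, StrictMono w ∧ 0 < w 0 ∧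
      (∀ i, (∑ k, w i ^ d k • (((-1 : ℝ) ^ d k) • S k)).det ≠ 0) ∧
      (∀ t, 0 < t → (∑ k, t ^ d k • (((-1 : ℝ) ^ d k) • S k)).det = 0 → w 0 < t ∧ t < w (Fin.last (K + 1))) ∧
      (∀ i : Fin (K + 1),
        (∀ t, w i.castSucc < t → t < w i.succ → (∑ k, t ^ d k • (((-1 : ℝ) ^ d k) • S k)).det = 0 → ∀ u : Fin m → ℝ,
          (∑ k, t ^ d k • (((-1 : ℝ) ^ d k) • S k)) *ᵥ u = 0 → u ≠ 0 →
            (derivative (∑ k, C (u ⬝ᵥ ((((-1 : ℝ) ^ d k) • S k) *ᵥ u)) * (X : ℝ[X]) ^ d k)).eval t < 0) ∨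
        (∀ t, w i.castSucc < t → t < w i.succ → (∑ k, t ^ d k • (((-1 : ℝ) ^ d k) • S k)).det = 0 → ∀ u : Fin m → ℝ,
          (∑ k, t ^ d k • (((-1 : ℝ) ^ d k) • S k)) *ᵥ u = 0 → u ≠ 0 →
            0 < (derivative (∑ k, C (u ⬝ᵥ ((((-1 : ℝ) ^ d k) • S k) *ᵥ u)) * (X : ℝ[X]) ^ d k)).eval t))) :
    (Matrix.det (∑ l, ((X : ℝ[X]) ^ d l) • (S l).map C)).roots.toFinset.card ≤ (K + 1) * m + (K + 1) * m + 1 := by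
  have h1 := card_posRoots_le_of_typeRuns d S hS hruns
  have h2 := card_posRoots_le_of_typeRuns d (fun l => ((-1 : ℝ) ^ d l) • S l) (fun l => (hS l).smul _) hruns'
  have h3 := stub_negRoots K m d S
  omega

/-! ## §2 The crux's inequality on the sector -/

/-- **The crux inequality on the two-sided few-type-runs sector, every fat format.**  For all `c, q` there is `K₀` such that for
`K ≥ K₀`, `m ≤ 2^{(⌊log₂K⌋+c)^c}`, all exponents and all real symmetric letters such that `F(X)` and `F(−X)` both admit type-run
partitions with `K + 1` windows: `Z^q ≤ 2^{K⌊log₂K⌋}`. [folklore] -/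
theorem typeRuns_mdr (c q : ℕ) : ∃ K₀ : ℕ, ∀ K m : ℕ, K₀ ≤ K → m ≤ 2 ^ ((Nat.log 2 K + c) ^ c) →
    ∀ (d : Fin K → ℕ) (S : Fin K → Matrix (Fin m) (Fin m) ℝ), (∀ l, (S l).IsSymm) →
    (∃ w : Fin (K + 2) → ℝ, StrictMono w ∧ 0 < w 0 ∧ (∀ i, (∑ k, w i ^ d k • S k).det ≠ 0) ∧
      (∀ t, 0 < t → (∑ k, t ^ d k • S k).det = 0 → w 0 < t ∧ t < w (Fin.last (K + 1))) ∧
      (∀ i : Fin (K + 1),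
        (∀ t, w i.castSucc < t → t < w i.succ → (∑ k, t ^ d k • S k).det = 0 → ∀ u : Fin m → ℝ,
          (∑ k, t ^ d k • S k) *ᵥ u = 0 → u ≠ 0 →
            (derivative (∑ k, C (u ⬝ᵥ (S k *ᵥ u)) * (X : ℝ[X]) ^ d k)).eval t < 0) ∨
        (∀ t, w i.castSucc < t → t < w i.succ → (∑ k, t ^ d k • S k).det = 0 → ∀ u : Fin m → ℝ,
          (∑ k, t ^ d k • S k) *ᵥ u = 0 → u ≠ 0 →
            0 < (derivative (∑ k, C (u ⬝ᵥ (S k *ᵥ u)) * (X : ℝ[X]) ^ d k)).eval t))) →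
    (∃ w : Fin (K + 2) → ℝ, StrictMono w ∧ 0 < w 0 ∧
      (∀ i, (∑ k, w i ^ d k • (((-1 : ℝ) ^ d k) • S k)).det ≠ 0) ∧
      (∀ t, 0 < t → (∑ k, t ^ d k • (((-1 : ℝ) ^ d k) • S k)).det = 0 → w 0 < t ∧ t < w (Fin.last (K + 1))) ∧
      (∀ i : Fin (K + 1),
        (∀ t, w i.castSucc < t → t < w i.succ → (∑ k, t ^ d k • (((-1 : ℝ) ^ d k) • S k)).det = 0 → ∀ u : Fin m → ℝ,
          (∑ k, t ^ d k • (((-1 : ℝ) ^ d k) • S k)) *ᵥ u = 0 → u ≠ 0 →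
            (derivative (∑ k, C (u ⬝ᵥ ((((-1 : ℝ) ^ d k) • S k) *ᵥ u)) * (X : ℝ[X]) ^ d k)).eval t < 0) ∨
        (∀ t, w i.castSucc < t → t < w i.succ → (∑ k, t ^ d k • (((-1 : ℝ) ^ d k) • S k)).det = 0 → ∀ u : Fin m → ℝ,
          (∑ k, t ^ d k • (((-1 : ℝ) ^ d k) • S k)) *ᵥ u = 0 → u ≠ 0 →
            0 < (derivative (∑ k, C (u ⬝ᵥ ((((-1 : ℝ) ^ d k) • S k) *ᵥ u)) * (X : ℝ[X]) ^ d k)).eval t))) →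
    (Matrix.det (∑ l, ((X : ℝ[X]) ^ d l) • (S l).map C)).roots.toFinset.card ^ q ≤ 2 ^ (K * Nat.log 2 K) := by
  obtain ⟨K₀, hK₀⟩ := Census.fatFormat_absorb 1 c q
  refine ⟨K₀, fun K m hK hm d S hS hruns hruns' => hK₀ K m _ hK hm ?_⟩
  have hZ := typeRuns_realRoots_le K m d S hS hruns hruns'
  have h4 : (K + 1) * m + (K + 1) * m + 1 ≤ 2 ^ 1 * (m + 1) * (K + 1) := by nlinarith
  exact hZ.trans h4

end Inertia

end Summit.ValiantsHypothesis.ValiantsHypothesis.Theorems.LacunarySymmetroidMatrixDescartes
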